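import Summits.CriticalPhenomena.CardyFormulaZ2.Theorems.CardySusyWardParafermionPrecompactFourDartSplit
import Literature.Probability.LatticeModels.MedialInterfaceMeasurability

/-!
# The four-class vertex transfer — route-free core

Line `four-class-vertex-transfer` of the crux `ParafermionPrecompact` (route `CardySusyWard`, item
stmt-CriticalPhenomena-11293), lead `prover-line-stmt-CriticalPhenomena-11293-c1-0`. This file carries
the whole mathematical content of the line in a ROUTE-FREE import cone (no `Theses.*`, no `Negative.*`:
only the pathwise four-dart split `…FourDartSplit` over the vocabulary `…KenyonDefs`, and the
measurability of the exploration); the by-name statements for the repaired crux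
`Negative.ParafermionPrecompactRepairedAt` (`…FourClassTransfer`) and for `CardyComplexCone.EdgePrecompact`
(`…FourClassTransferOfEdgePrecompact`) are one-line unfoldings of the theorems below.

* `vertexObs_eq_kappa_mul_sum`, `vertexDictionary_eventually` — the dart dictionary with the vertex
  observable written out as `∫ passageSum (medialExploration (Λ δ) ω) δ (1/3) z dP_{1/2}`: at one mesh
  (`(Λ δ).δ = δ > 0`, `z = mv (x, i)` not an `A`–`B` edge) and eventually in `δ` on a compact
  `K ⊆ Ω` under the marks hypothesis of a family (the two `A`–`B` edges tend to `{a, b} ⊆ ∂Ω`):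
  `∫ passageSum … (mv (x, i)) = κ Σ_{q<4} g_q(pivotOf x i q)`, `g_q = classComp (dartField (Λ δ)) q`.
* `repairedClauses_of_classBounds` — **the transfer, per `(D, Λ)`**: a class-component bound
  `‖g_q(w)‖ ≤ C δ^{1/3}` and SAME-CLASS equicontinuity `‖g_q(w) - g_q(w')‖ ≤ ε δ^{1/3}` on compacts
  give the two edge-guarded clauses of the repaired crux on every compact `K ⊆ Ω` (constant `4C`;
  `η = η'(ε/4)/2`, meshes `δ < η'/4`), pairing only the class-`q` pivot of `z` with the class-`q`
  pivot of `z'` — no cross-class input.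

References: S. Smirnov, Ann. of Math. 172 (2010), §2.2 [Smirnov2010]; H. Duminil-Copin, S. Smirnov,
Clay Math. Proc. 15 (2012), §8.3 [DuminilCopinSmirnov2012Lattice].
-/

noncomputable section

namespace Summit.CriticalPhenomena.CardyFormulaZ2.Cruxes.ParafermionPrecompact.FourClassVertexTransfer

open scoped BigOperators Topology
open Filter Set MeasureTheory
open _root_.Literature.Probability.LatticeModels
open _root_.Literature.Probability.RandomPlanarGeometry (DobrushinDomain)
open _root_.Literature.Probability.Percolation (BondConfig bondPercolation half)
open KenyonStreamSecondRelation (mv ex pivotOf classOffset classComp dartField kappa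
  kappa_pos_le norm_kappa_le dist_pivotOf_le fourDart_split_medialExploration)

/-! ### The dart dictionary, route-free -/

/-- **The dictionary at one mesh**, vertex observable written out: if `(Λ δ).δ = δ > 0` and the
genuine medial vertex `mv (x, i)` is not an `A`–`B` edge of `Λ δ`, then
`∫ passageSum γ δ (1/3) (mv (x, i)) dP = κ Σ_q g_q(pivotOf x i q)`. [folklore] -/
theorem vertexObs_eq_kappa_mul_sum (Λ : ℝ → DiscreteDobrushin) {δ : ℝ} (hδ : 0 < δ)
    (hΛ : (Λ δ).δ = δ) (x : Site 2) (i : Fin 2) (hz : mv (x, i) ∉ (Λ δ).zdABEdges) :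
    (∫ ω, MedialPath.passageSum (medialExploration (Λ δ) ω) δ (1 / 3) (mv (x, i))
        ∂(bondPercolation (zdGraph 2) half)) =
      (kappa : ℂ) * ∑ q : Fin 4, classComp (dartField (Λ δ)) q (pivotOf x i q) := by
  -- `κ · 2cos(π/12) = 1`
  have hκ : (kappa : ℂ) * ((2 * Real.cos (Real.pi / 12) : ℝ) : ℂ) = 1 := by
    have h : (2 * Real.cos (Real.pi / 12) : ℝ) ≠ 0 := by
      have := kappa_pos_le.1
      rw [kappa, inv_pos] at this
      exact this.ne'
    rw [kappa, Complex.ofReal_inv, inv_mul_cancel₀]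
    exact_mod_cast h
  -- integrability of each dart phase (bounded by `1`, a function of the exploration path)
  have hint : ∀ c : Site 2 × Site 2,
      Integrable (fun ω => Parafermion.dartPhaseSum (medialExploration (Λ δ) ω) δ (1 / 3) c)
        (bondPercolation (zdGraph 2) half) := fun c =>
    Integrable.of_bound
      (measurable_of_medialExploration (Λ δ)
        (F := fun ω => Parafermion.dartPhaseSum (medialExploration (Λ δ) ω) δ (1 / 3) c)
        (fun _ _ h => by simp only [h])).aestronglyMeasurable 1
      (ae_of_all _ fun ω => Parafermion.norm_dartPhaseSum_le_one
        (Parafermion.nodup_zip_tail_medialExploration (Λ δ) ω) δ (1 / 3) c)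
  have key : ∀ ω, MedialPath.passageSum (medialExploration (Λ δ) ω) δ (1 / 3) (mv (x, i)) =
      (kappa : ℂ) * ∑ q : Fin 4, Parafermion.dartPhaseSum (medialExploration (Λ δ) ω) δ (1 / 3)
        (pivotOf x i q, pivotOf x i q + classOffset q) := fun ω => by
    rw [← fourDart_split_medialExploration (Λ δ) δ hδ.ne' ω x i hz, ← mul_assoc, hκ, one_mul]
  simp only [key, integral_const_mul]
  rw [integral_finsetSum _ fun q _ => hint _]
  simp only [classComp, dartField, Parafermion.bondDartObservable_def, hΛ]

/-- **The dictionary, eventually on compacts**: under the mesh and marks hypotheses of a family of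
the Dobrushin domain `D`, for a compact `K ⊆ Ω`, eventually as `δ → 0⁺` the identity holds at every
genuine medial vertex with midpoint in `K` (the two `A`–`B` edges have midpoints tending to the
marked points of `∂Ω`, at positive distance from `K`). [folklore] -/
theorem vertexDictionary_eventually (D : DobrushinDomain) (Λ : ℝ → DiscreteDobrushin)
    (hδ : ∀ δ, (Λ δ).δ = δ)
    (hAB : Tendsto (fun δ : ℝ => Metric.hausdorffEDist (medialPoint δ '' (Λ δ).zdABEdges)
      {D.pt 0, D.pt 1}) (𝓝[>] 0) (𝓝 0))
    (K : Set ℂ) (hK : IsCompact K) (hKD : K ⊆ D.carrier) :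
    ∀ᶠ δ in 𝓝[>] (0:ℝ), ∀ (x : Site 2) (i : Fin 2), medialPoint δ (mv (x, i)) ∈ K →
      (∫ ω, MedialPath.passageSum (medialExploration (Λ δ) ω) δ (1 / 3) (mv (x, i))
          ∂(bondPercolation (zdGraph 2) half)) =
        (kappa : ℂ) * ∑ q : Fin 4, classComp (dartField (Λ δ)) q (pivotOf x i q) := by
  obtain ⟨r, hr, hrK⟩ := hK.exists_cthickening_subset_open D.isOpen hKD
  have hev : ∀ᶠ δ in 𝓝[>] (0:ℝ), Metric.hausdorffEDist (medialPoint δ '' (Λ δ).zdABEdges)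
      {D.pt 0, D.pt 1} < ENNReal.ofReal r :=
    hAB.eventually (gt_mem_nhds (ENNReal.ofReal_pos.2 hr))
  filter_upwards [hev, self_mem_nhdsWithin] with δ hδlt hδpos x i hxK
  refine vertexObs_eq_kappa_mul_sum Λ hδpos (hδ δ) x i fun hz => ?_
  obtain ⟨y, hy, hdist⟩ :=
    Metric.exists_edist_lt_of_hausdorffEDist_lt (mem_image_of_mem _ hz) hδlt
  have hyf : y ∈ frontier D.carrier := by
    rcases hy with rfl | rfl <;> exact D.pt_mem_frontier _
  have hyD : y ∈ D.carrier := hrK (Metric.mem_cthickening_of_dist_le _ _ _ _ hxK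
    (by rw [dist_comm]; exact (edist_lt_ofReal.1 hdist).le))
  exact hyf.2 (interior_maximal Subset.rfl D.isOpen hyD)

/-! ### Glue -/

/-- Every nearest-neighbour edge of `ℤ²` is `mv (x, i)` for some site `x` and direction `i`. [folklore] -/
theorem exists_eq_mv {z : MedialVertex} (hz : z ∈ (zdGraph 2).edgeSet) :
    ∃ (x : Site 2) (i : Fin 2), z = mv (x, i) := by
  induction z using Sym2.ind with
  | h a b =>
    rw [SimpleGraph.mem_edgeSet, zdGraph_adj_iff] at hz
    obtain ⟨i, h | h⟩ := hz
    · exact ⟨a, i, by rw [h]; rfl⟩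
    · exact ⟨b, i, by rw [h, Sym2.eq_swap]; rfl⟩

/-- `‖κ Σ_{q<4} a_q‖ ≤ Σ_q ‖a_q‖` (`‖κ‖ ≤ 1`). [folklore] -/
theorem norm_kappa_mul_sum_le (a : Fin 4 → ℂ) :
    ‖(kappa : ℂ) * ∑ q : Fin 4, a q‖ ≤ ∑ q : Fin 4, ‖a q‖ := by
  rw [norm_mul]
  calc ‖(kappa : ℂ)‖ * ‖∑ q : Fin 4, a q‖ ≤ 1 * ‖∑ q : Fin 4, a q‖ :=
        mul_le_mul_of_nonneg_right norm_kappa_le (norm_nonneg _)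
    _ = ‖∑ q : Fin 4, a q‖ := one_mul _
    _ ≤ ∑ q : Fin 4, ‖a q‖ := norm_sum_le _ _

/-- A sum of four terms each `≤ b` is `≤ 4 b`. [folklore] -/
theorem sum_four_le {a : Fin 4 → ℝ} {b : ℝ} (h : ∀ q, a q ≤ b) : ∑ q : Fin 4, a q ≤ 4 * b :=
  calc ∑ q : Fin 4, a q ≤ ∑ _q : Fin 4, b := Finset.sum_le_sum fun q _ => h q
    _ = 4 * b := by simp

/-- Pivots of a medial vertex with midpoint in `K` lie in the closed `ρ`-thickening of `K` once
`0 ≤ δ ≤ ρ`. [folklore] -/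
theorem pivot_mem_cthickening {δ ρ : ℝ} (hδ : 0 ≤ δ) (hδρ : δ ≤ ρ) {K : Set ℂ} (x : Site 2)
    (i : Fin 2) (q : Fin 4) (hz : medialPoint δ (mv (x, i)) ∈ K) :
    meshPoint δ (pivotOf x i q) ∈ Metric.cthickening ρ K :=
  Metric.mem_cthickening_of_dist_le _ _ _ _ hz ((dist_pivotOf_le hδ x i q).trans hδρ)

/-- Pivots of two medial vertices at distance `< η'/2` are at distance `< η'` once `δ < η'/4`. [folklore] -/
theorem dist_pivot_lt {δ η' : ℝ} (hδ : 0 ≤ δ) (hδη : δ < η' / 4) (x x' : Site 2) (i i' : Fin 2)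
    (q : Fin 4) (hd : dist (medialPoint δ (mv (x, i))) (medialPoint δ (mv (x', i'))) < η' / 2) :
    dist (meshPoint δ (pivotOf x i q)) (meshPoint δ (pivotOf x' i' q)) < η' :=
  calc dist (meshPoint δ (pivotOf x i q)) (meshPoint δ (pivotOf x' i' q))
      ≤ dist (meshPoint δ (pivotOf x i q)) (medialPoint δ (mv (x, i))) +
          dist (medialPoint δ (mv (x, i))) (medialPoint δ (mv (x', i'))) +
          dist (medialPoint δ (mv (x', i'))) (meshPoint δ (pivotOf x' i' q)) := dist_triangle4 _ _ _ _
    _ < δ + η' / 2 + δ := by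
        have h1 := dist_pivotOf_le hδ x i q
        have h2 := dist_pivotOf_le hδ x' i' q
        rw [dist_comm] at h2
        linarith
    _ ≤ η' := by linarith

/-! ### The transfer, per domain and family, route-free -/

/-- **The four-class vertex transfer (per `(D, Λ)`, clauses written out).** Under the mesh and marks
hypotheses of a family of `D`, if the class components `g_q = classComp (dartField (Λ δ)) q` obey on
every compact `K ⊆ Ω`, eventually in `δ`, (a) `‖g_q(w)‖ ≤ C δ^{1/3}` for `δw ∈ K` and (b) SAME-CLASS
equicontinuity `‖g_q(w) - g_q(w')‖ ≤ ε δ^{1/3}` for `δw, δw' ∈ K` at distance `< η(ε)`, then on every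
compact `K ⊆ Ω` the vertex observable `V_δ(z) = ∫ passageSum (medialExploration (Λ δ) ω) δ (1/3) z dP`
satisfies the two EDGE-GUARDED clauses of the repaired crux: (i) `‖V_δ(z)‖ ≤ 4C δ^{1/3}` and (ii)
`‖V_δ(z) - V_δ(z')‖ ≤ ε δ^{1/3}` for genuine `z, z'` with midpoints in `K` at distance `< η`. [folklore] -/
theorem repairedClauses_of_classBounds :
    ∀ (D : DobrushinDomain) (Λ : ℝ → DiscreteDobrushin), (∀ δ, (Λ δ).δ = δ) → Tendsto (fun δ : ℝ => Metric.hausdorffEDist (medialPoint δ '' (Λ δ).zdABEdges) {D.pt 0, D.pt 1}) (𝓝[>] 0) (𝓝 0) → (∀ K : Set ℂ, IsCompact K → K ⊆ D.carrier → ∃ C : ℝ, ∀ᶠ δ in 𝓝[>] (0:ℝ), ∀ (q : Fin 4) (w : Site 2), meshPoint δ w ∈ K → ‖classComp (dartField (Λ δ)) q w‖ ≤ C * δ ^ ((1:ℝ) / 3)) → (∀ K : Set ℂ, IsCompact K → K ⊆ D.carrier → ∀ ε > (0:ℝ), ∃ η > (0:ℝ), ∀ᶠ δ in 𝓝[>]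 (0:ℝ), ∀ (q : Fin 4) (w w' : Site 2), meshPoint δ w ∈ K → meshPoint δ w' ∈ K → dist (meshPoint δ w) (meshPoint δ w') < η → ‖classComp (dartField (Λ δ)) q w - classComp (dartField (Λ δ)) q w'‖ ≤ ε * δ ^ ((1:ℝ) / 3)) → ∀ K : Set ℂ, IsCompact K → K ⊆ D.carrier → (∃ C : ℝ, ∀ᶠ δ in 𝓝[>] (0:ℝ), ∀ z : MedialVertex, z ∈ (zdGraph 2).edgeSet → medialPoint δ z ∈ K → ‖∫ ω, MedialPath.passageSum (medialExploration (Λ δ) ω) δ (1 / 3) z ∂(bondPercolation (zdGraph 2) half)‖ ≤ C * δ ^ ((1:ℝ) / 3)) ∧ (∀ ε > (0:ℝ), ∃ η > (0:ℝ), ∀ᶠ δ in 𝓝[>] (0:ℝ), ∀ z z' : MedialVertex, z ∈ (zdGraph 2).edgeSet → z' ∈ (zdGraph 2).edgeSet → medialPoint δ z ∈ K → medialPoint δ z' ∈ K → dist (medialPoint δ z) (medialPoint δ z') < η → ‖(∫ ω, MedialPath.passageSum (medialExploration (Λ δ) ω) δ (1 / 3) z ∂(bondPercolation (zdGraph 2)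 half)) - ∫ ω, MedialPath.passageSum (medialExploration (Λ δ) ω) δ (1 / 3) z' ∂(bondPercolation (zdGraph 2) half)‖ ≤ ε * δ ^ ((1:ℝ) / 3)) := by
  intro D Λ hδ hAB hbound hequi K hK hKD
  have hdict := vertexDictionary_eventually D Λ hδ hAB K hK hKD
  -- an inner collar for `K`: pivots of vertices with midpoint in `K` lie in `K' = cthickening ρ K`
  obtain ⟨ρ, hρ, hρK⟩ := hK.exists_cthickening_subset_open D.isOpen hKD
  obtain ⟨C, hC⟩ := hbound (Metric.cthickening ρ K) hK.cthickening hρK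
  have hii := hequi (Metric.cthickening ρ K) hK.cthickening hρK
  have hpos : ∀ᶠ δ in 𝓝[>] (0:ℝ), 0 < δ := eventually_mem_nhdsWithin
  have hltρ : ∀ᶠ δ in 𝓝[>] (0:ℝ), δ < ρ := (eventually_lt_nhds hρ).filter_mono nhdsWithin_le_nhds
  refine ⟨⟨4 * C, ?_⟩, ?_⟩
  · -- clause (i): triangle inequality over the four classes
    filter_upwards [hC, hdict, hpos, hltρ] with δ hCδ hdictδ hδ0 hδρ
    intro z hz hzK
    obtain ⟨x, i, rfl⟩ := exists_eq_mv hz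
    have hq : ∀ q : Fin 4, ‖classComp (dartField (Λ δ)) q (pivotOf x i q)‖ ≤ C * δ ^ ((1:ℝ) / 3) :=
      fun q => hCδ q _ (pivot_mem_cthickening hδ0.le hδρ.le x i q hzK)
    rw [hdictδ x i hzK]
    calc ‖(kappa : ℂ) * ∑ q : Fin 4, classComp (dartField (Λ δ)) q (pivotOf x i q)‖
        ≤ ∑ q : Fin 4, ‖classComp (dartField (Λ δ)) q (pivotOf x i q)‖ := norm_kappa_mul_sum_le _
      _ ≤ 4 * (C * δ ^ ((1:ℝ) / 3)) := sum_four_le hq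
      _ = 4 * C * δ ^ ((1:ℝ) / 3) := by ring
  · -- clause (ii): same-class pairing
    intro ε hε
    obtain ⟨η', hη', hev⟩ := hii (ε / 4) (by positivity)
    refine ⟨η' / 2, by positivity, ?_⟩
    have hltη : ∀ᶠ δ in 𝓝[>] (0:ℝ), δ < η' / 4 :=
      (eventually_lt_nhds (by positivity : (0:ℝ) < η' / 4)).filter_mono nhdsWithin_le_nhds
    filter_upwards [hev, hdict, hpos, hltρ, hltη] with δ hevδ hdictδ hδ0 hδρ hδη
    intro z z' hz hz' hzK hz'K hdist
    obtain ⟨x, i, rfl⟩ := exists_eq_mv hz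
    obtain ⟨x', i', rfl⟩ := exists_eq_mv hz'
    have hq : ∀ q : Fin 4,
        ‖classComp (dartField (Λ δ)) q (pivotOf x i q) -
            classComp (dartField (Λ δ)) q (pivotOf x' i' q)‖ ≤ ε / 4 * δ ^ ((1:ℝ) / 3) :=
      fun q => hevδ q _ _ (pivot_mem_cthickening hδ0.le hδρ.le x i q hzK)
        (pivot_mem_cthickening hδ0.le hδρ.le x' i' q hz'K) (dist_pivot_lt hδ0.le hδη x x' i i' q hdist)
    rw [hdictδ x i hzK, hdictδ x' i' hz'K, ← mul_sub, ← Finset.sum_sub_distrib]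
    calc ‖(kappa : ℂ) * ∑ q : Fin 4, (classComp (dartField (Λ δ)) q (pivotOf x i q) -
            classComp (dartField (Λ δ)) q (pivotOf x' i' q))‖
        ≤ ∑ q : Fin 4, ‖classComp (dartField (Λ δ)) q (pivotOf x i q) -
            classComp (dartField (Λ δ)) q (pivotOf x' i' q)‖ := norm_kappa_mul_sum_le _
      _ ≤ 4 * (ε / 4 * δ ^ ((1:ℝ) / 3)) := sum_four_le hq
      _ = ε * δ ^ ((1:ℝ) / 3) := by ring

end Summit.CriticalPhenomena.CardyFormulaZ2.Cruxes.ParafermionPrecompact.FourClassVertexTransfer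

end
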